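import Mathlib.Analysis.Meromorphic.Basic
import Mathlib.Analysis.Complex.Basic
import Literature.NumberTheory.GaloisRepresentations.ArtinLFunction
import Literature.NumberTheory.Automorphic.HilbertRepSpectrum
import Literature.NumberTheory.Automorphic.GLnCuspidalSpectrum
import Literature.NumberTheory.Automorphic.AutomorphicLFunction
import HarnessLib

-- provenance: harness21/H21/H21/Statements/Lang/AutomorphicLFunctions.lean @ 984ed8e (interim HEAD d8f2665); M5 mechanical rewrite
/-!
# Godement–Jacquet: analytic continuation and functional equation of standard L-functions
(family `lang`, trunk G19 AutomorphicAxiomatic; statement **lang.S21**)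

Informal content (Godement–Jacquet, *Zeta functions of simple algebras*, LNM 260 (1972),
Thm. 13.8; Jacquet, *Principal L-functions of the linear group*, Corvallis (1979), Part 2,
Thm. (6.2); Jacquet–Shalika, Amer. J. Math. 103 (1981)): the standard L-function
`L(s, Π) = ∏_v L(s, Π_v)` of a cuspidal automorphic representation `Π` of `GL_n(𝔸_K)` — other
than the characters `|det|^{it}` of `GL_1`, i.e. (with the `A_G = ℝ_{>0}` normalisation of outline
D10) other than the trivial representation of `GL_1` — extends to an entire function of `s`, and
its completion `Λ(s, Π) = N^{s/2} γ(s, Π_∞) L(s, Π)` satisfies the functional equation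
`Λ(1 - s, Π) = ε(Π) Λ(s, Π̃)` with `Π̃` the contragredient, whose Satake parameters are the
inverses of those of `Π`. For every cuspidal `Π` (including the trivial representation of
`GL_1`, where `L(s, Π) = ζ_K(s)` has a simple pole at `s = 1`) `L(s, Π)` is meromorphic on `ℂ`,
and so is every partial L-function `L^S(s, Π)` (finitely many polynomial Euler factors removed).

## Formal shape (outline D3, §3, §4.3(d); review F1)

All three declarations are `theorem … := by sorry` (known theorems in print) in
`namespace Literature.Lang`, tagged **lang.S21**, over a number field `K`, for
`Π : CuspidalAutomorphicRepGL n K μ` with `[(AdelicGroupData.gl n K).IsAutomorphicMeasure μ]`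
(outline D11), consuming the accepted C16 carriers `StandardLFunctionData`, `StandardLFunctionData.L`,
`ArchimedeanLData`, `dualFamily`, `SatisfiesFunctionalEquation`, `partialStandardL`,
`IsSatakeFamilyOf` (`Literature.Prelude.AutomorphicAxiomatic.AutomorphicLFunction`) and the accepted G09
predicates `LFunction.HasEntireContinuation` / `LFunction.HasMeromorphicContinuation`
(`Literature.Prelude.GalRep.ArtinLFunction`).

* `Lang.godementJacquet` is the **existence form**: there is *some* datum `D` (the true
  Godement–Jacquet local factors at the ramified places) whose L-function is entire, together
  with a cuspidal `Π'` in the same `L²(μ)` (the contragredient `Π̃ ≅ conj ∘ Π`, realised on the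
  complex-conjugate functions, lives in the same `L²(μ)`, so the same measure `μ` is used), a
  datum `D'` for `Π'` whose Satake family is the dual family of that of `D` off the exceptional
  places, and archimedean data `A, A'` of degree `n · [K : ℚ]` satisfying the functional
  equation. The hypothesis `2 ≤ n ∨ ¬ Π.1.IsTrivialSubrep` excludes exactly the trivial
  representation of `GL_1` (`IsTrivialSubrep` of `HilbertRepSpectrum`: `GL_1(𝔸_K)` acts
  trivially), the only cuspidal `Π` (in the `A_G`-normalisation) whose standard L-function has a
  pole; for `n = 1` this is the honest Hecke–Tate theorem (the vacuous `godementJacquet_gl1` of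
  outline revision 1 is not written, review F1).
* `Lang.godementJacquet_hasMeromorphicContinuation`: for every cuspidal `Π`, some datum has
  meromorphic `L`.
* `Lang.partialStandardL_hasMeromorphicContinuation`: every honest partial standard L-function
  `L^S(s, Π)` (`S` finite, containing all ramified places) is meromorphic on `ℂ`.

## Faithfulness caveat (outline §4.3)

`StandardLFunctionData Π` is a hypothesis-structure whose local factors at the (genuinely
ramified) places `v ∈ D.S` are free polynomials of degree `≤ n` with constant term `1`; only off
`D.S` are they pinned to honest Satake parameters. Hence lang.S21 is stated as an `∃ D`
statement: the *true* Godement–Jacquet data exist and have the asserted properties, which is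
exactly what the theorem in print provides; a universally quantified form `∀ D` would be false
(junk ramified factors `P'_v` can introduce poles of `1 / P'_v(q_v^{-s})`). Weaker-than-print is
acceptable for a *theorem* (outline §4.3(d)). Likewise the root number and gamma shifts are
existentially quantified inside `ArchimedeanLData` / `SatisfiesFunctionalEquation`; the ε-factor
`ε(s, Π) = ε N^{1/2 - s}` of the inventory text is split into `A.rootNumber` and the conductor
power inside `completedL`.

## Mathlib search

Mathlib (this pin) has `Meromorphic`, `Differentiable`, `Complex.Gammaℝ`, `riemannZeta`,
`NumberField.dedekindZeta` and Dirichlet/Hecke-character L-series, but no automorphic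
representations, Satake parameters or Godement–Jacquet L-functions (grep `Godement`, `Jacquet`,
`automorphic`, `Satake` in `Mathlib/`: no hits). Nothing here duplicates a Mathlib declaration;
no new definitions are introduced in this file.
-/

noncomputable section

open scoped MatrixGroups
open NumberField IsDedekindDomain MeasureTheory Complex
open Literature.NumberTheory.Automorphic

namespace Literature.NumberTheory.Automorphic

variable {n : ℕ} {K : Type} [Field K] [NumberField K]
  {μ : Measure (AdelicGroupData.gl n K).automorphicQuotient}
  [(AdelicGroupData.gl n K).IsAutomorphicMeasure μ]

/-- **lang.S21** (Godement–Jacquet, LNM 260 (1972), Thm. 13.8; Jacquet, Corvallis (1979),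
Thm. (6.2); Jacquet–Shalika, Amer. J. Math. 103 (1981); existence form per outline D3/§4.3(d)).
Let `Π` be a cuspidal automorphic representation of `GL_n(𝔸_K)` which is not the trivial
representation of `GL_1` (hypothesis `h`: automatic for `n ≥ 2`; for `n = 1`, with the
`A_G = ℝ_{>0}`-normalisation of outline D10, the characters `|·|^{it}` collapse to the trivial
character, the only cuspidal `Π` whose L-function — `ζ_K` — has a pole). Then there is a standard
L-function datum `D` for `Π` (the true Godement–Jacquet local factors) such that
`L(s, Π) = D.L` **extends to an entire function**, and there are a cuspidal `Π'` (the
contragredient `Π̃`, realised in the same `L²(μ)`), a datum `D'` for `Π'` whose Satake parameters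
off the exceptional places are the inverses of those of `Π` (`D'.α v = dualFamily D.α v`), and
archimedean data `A, A'` of degree `n · [K : ℚ]`, such that the completed L-functions satisfy the
**functional equation** `Λ(1 - s, Π) = ε Λ'(s, Π̃)` (`SatisfiesFunctionalEquation`). The
exceptional set `D.S ∪ D'.S` is written as a union of `Set`s (`HeightOneSpectrum` carries no
`DecidableEq` instance, so `Finset` union is unavailable without `Classical`). Faithfulness
caveat: `∃ D`-form, junk ramified factors of other data are not constrained (module docstring).
[cite: JacquetCorvallis1979, Thm. (6.2)] [cite: GodementJacquet1972, Thm. 13.8] -/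
def godementJacquet : Prop :=
  ∀ (P : CuspidalAutomorphicRepGL n K μ) (h : 2 ≤ n ∨ ¬ P.1.IsTrivialSubrep),
    ∃ D : StandardLFunctionData P, GaloisRepresentations.LFunction.HasEntireContinuation D.L ∧
      ∃ (P' : CuspidalAutomorphicRepGL n K μ) (D' : StandardLFunctionData P')
        (A A' : ArchimedeanLData (n * Module.finrank ℚ K)),
        (∀ v ∉ (↑D.S ∪ ↑D'.S : Set (HeightOneSpectrum (𝓞 K))), D'.α v = dualFamily D.α v) ∧
          SatisfiesFunctionalEquation D A D' A'

/-- **lang.S21** (meromorphic continuation, all `Π`; Godement–Jacquet, LNM 260 (1972),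
Thm. 13.8; Jacquet–Shalika, Amer. J. Math. 103 (1981), Thm. 5.3). For every cuspidal automorphic
representation `Π` of `GL_n(𝔸_K)` — including the trivial representation of `GL_1`, where the
canonical datum has `D.L = ζ_K` on `re s > 1` — some standard L-function datum `D` (the true
Godement–Jacquet factors) has `D.L` **meromorphic on `ℂ`**
(`LFunction.HasMeromorphicContinuation`). `∃ D`-form (faithfulness caveat of the module
docstring). [cite: GodementJacquet1972, Thm. 13.8] [cite: JacquetShalika1981, Thm. 5.3] -/
def godementJacquet_hasMeromorphicContinuation : Prop :=
  ∀ (P : CuspidalAutomorphicRepGL n K μ),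
    ∃ D : StandardLFunctionData P, GaloisRepresentations.LFunction.HasMeromorphicContinuation D.L

/-- **lang.S21** (partial L-functions; Godement–Jacquet, LNM 260 (1972), Thm. 13.8 with
Thm. 3.3 (local factors are inverses of polynomials in `q_v^{-s}`); Jacquet–Shalika, Amer. J.
Math. 103 (1981), §1 and Thm. 5.3). Let `Π` be a cuspidal automorphic representation of
`GL_n(𝔸_K)`, `S` a finite set of finite places containing every ramified place of `Π`
(hypothesis `hS`), and `α` an honest Satake family of `Π` away from `S`. Then the partial standard
L-function `L^S(s, Π) = ∏_{v ∉ S} ∏_{a ∈ α v} (1 - a q_v^{-s})⁻¹` (genuine value on `re s > 1` by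
`multipliable_partialStandardL`) **has meromorphic continuation to `ℂ`**: it differs from the
meromorphic `L(s, Π)` by finitely many entire factors `P_v(q_v^{-s})`, `v ∈ S`. This statement
involves no junk local factors at all. [cite: GodementJacquet1972, Thm. 13.8 with Thm. 3.3] [cite: JacquetShalika1981, §1 and Thm. 5.3] -/
def partialStandardL_hasMeromorphicContinuation : Prop :=
  ∀ (P : CuspidalAutomorphicRepGL n K μ) (S : Finset (HeightOneSpectrum (𝓞 K))) (α : SatakeFamily K) (h : IsSatakeFamilyOf P ↑S α) (hS : ∀ v, IsUnramifiedAt P.1 v ∨ v ∈ S),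
    GaloisRepresentations.LFunction.HasMeromorphicContinuation (partialStandardL (↑S) α)

end Literature.NumberTheory.Automorphic
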